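/-
Copyright (c) 2026 the pub-hodgecm-mathlib formalisation cell (harness21).  Prover seat hodgecm-mathlib-K2E3-p06 (g6) (E3 hand lent to L1; LEAD F0P6-plan (g14) BATCH #106 (1);
desk K2E3-p14 (g9)), Track B «K2-LIT» ∕ hLiu418 = stmt-HodgeConjecture-24832: U1-CT-ind stage 3, brick B2a′, file W-FE-2a — the scalar `Γ^M_σ(e)` of the rank-one
ψ-Whittaker functional equation (★ W-FE-1b `K2LiuRankOneWhittakerFunctionalEquation`) IS A TATE ZETA INTEGRAL.  THEOREMS ONLY (no `def`∕`instance`∕notation∕`sorry`).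
-/
import Literature.NumberTheory.Automorphic.LocalFieldHaarBalls          -- ★ `integral_unitsMeasure`, `isHaarMeasure_unitsMeasure`, `tateZeta_unitsMeasure`, `measure_singleton_zero` (d^×x = ‖x‖⁻¹dx on Fˣ)
import Literature.NumberTheory.Automorphic.TateLocalZetaShells          -- ★ `isInvInvariant_of_isHaarMeasure_units`, `primePowBall`, `inv_residueFieldCard_zpow_le_iff`
import Mathlib.MeasureTheory.Group.Integral                              -- `integral_inv_eq_self`
import HarnessLib

/-!
# Crux `HLiu418`, organ U1-CT-ind STAGE 3 («U1-glob»), brick B2a′, file W-FE-2a: THE SCALAR OF THE RANK-ONE ψ-WHITTAKER FUNCTIONAL EQUATION IS A TATE ZETA INTEGRAL —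
# `∫_{x ∉ 𝔭^N} T(x) ψ(a x⁻¹) dμ(x) = C₀ · Z(ψ(a·)·𝟙_{𝔭^{1−N}}, ν, e − 1)` against `d^×x = ‖x‖⁻¹ dμ` [Tate1950 §2.3–2.5; CasselmanShalika1980 §4; KudlaRallis1994 §2]

Cell `hodgecm-mathlib`, crux item hLiu418 = `stmt-HodgeConjecture-24832`; squad K2, strike line L1, LEAD F0P6-plan (g14); desk K2E3-p14 (g9) + K2Liu-p13 (g4);
prover K2E3-p06 (g6).  Lane `--supports stmt-HodgeConjecture-24832 --as helper` (count-neutral).  GROUP-FREE: any non-archimedean local field `F`, additive Haar `μ`,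
`ψ : AddChar F Circle`, a homomorphism `ν : Fˣ →* ℂˣ`, scalars `C₀, e`, a TAIL LETTER `T x = C₀ ν(x)⁻¹ ‖x‖^{−e}` on `Fˣ` (★ W-FE-1b's letter), `a ∈ F` and a radius `N`.

THE POINT.  ★ W-FE-1b `twistedHeadSum_intertwined_eq_mul` proves the functional equation of the ψ_σ-twisted rank-one stage under the intertwining operator on `1 < re e`
with the EXPLICIT scalar `Γ^M_σ(e) = ∫_{x ∉ 𝔭^{M+k_κ+1}} T(x) ψ(σ·(κ·x⁻¹)) dμ(x)`.  Its continuation to the centre and its non-vanishing there (W-FE-2b∕3) want `Γ` in TATE's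
currency: writing `dμ = ‖x‖ d^×x` with `d^×x` the multiplicative Haar measure `μ^× := (‖·‖⁻¹μ)|_{Fˣ}` (★ `LocalFieldHaar.integral_unitsMeasure`, ★ `isHaarMeasure_unitsMeasure`),
then INVERTING `x ↦ x⁻¹` (★ `isInvInvariant_of_isHaarMeasure_units`: a Haar measure of the abelian group `Fˣ` is inversion invariant; Mathlib `integral_inv_eq_self`) turns
`‖x‖·𝟙_{x ∉ 𝔭^N}·C₀ν(x)⁻¹‖x‖^{−e}·ψ(a x⁻¹)` into `C₀ · ψ(a u)·𝟙_{𝔭^{1−N}}(u) · ν(u) · ‖u‖^{e−1}` — Tate's local zeta integrand of the Schwartz–Bruhat function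
`ψ(a·)·𝟙_{𝔭^{1−N}}` at the quasi-character `ν‖·‖^{e−1}`:
* §1 the pointwise bookkeeping (`inv_notMem_primePowBall_iff`: `x⁻¹ ∉ 𝔭^N ↔ x ∈ 𝔭^{1−N}` on `Fˣ`; `tail_inv_eq`: `T(u⁻¹) = C₀ ν(u) ‖u‖^{e}`);
* §2 **`setIntegral_compl_tail_addChar_inv_eq_integral_units`** — `∫_{x ∉ 𝔭^N} T(x) ψ(a x⁻¹) dμ = C₀·∫_{Fˣ} (ψ(a u) 𝟙_{𝔭^{1−N}}(u))·ν(u)·‖u‖^{e−1} dμ^×(u)`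
  (NO integrability needed: both Haar identities hold junk-or-not), and **`setIntegral_compl_tail_addChar_inv_eq_tateZeta`** — `= C₀ · tateZeta μ^× (ψ(a·)·𝟙_{𝔭^{1−N}}) η (e − 1)`
  for any quasi-character `η` agreeing with `ν` (★ `TateLocalFactors.tateZeta`), so that ★ Tate capital (`tateZeta_addChar_mul_indicator_primePowBall` — ramified `ν`: ONE Gauss-sum
  shell; the unramified shells) evaluates `Γ`.
What this file does NOT do: the dilation `u ↦ u∕a` (left to the evaluation), the closed forms and the centre value `Γ̃(1) ≠ 0` (W-FE-2b), the continuation (W-FE-3).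
References: [Tate1950] J. Tate, *Fourier analysis in number fields and Hecke's zeta-functions* (1950), §2.3–§2.5 (`d^×x`, the local zeta integral, `ζ(f̂, …)` for `f = 𝟙_{𝔭^n}`);
[CasselmanShalika1980] W. Casselman, J. Shalika, Compositio Math. 41 (1980), §4 (the local coefficient as a Tate-type integral); [KudlaRallis1994] S. Kudla, S. Rallis,
Ann. of Math. 140 (1994), §2; [Weil1967BNT] A. Weil, *Basic Number Theory* (1967), Ch. II §1 (Haar on `Fˣ`).
HONEST LABEL.  Count-neutral helper: `HC_CM` is proved only modulo the 7 printed citations (2 remaining named inputs: hLiu418 = `stmt-HodgeConjecture-24832`,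
h413 = `stmt-HodgeConjecture-24833`) until rung 0 closes; B2a′ OPEN (W-FE-2b∕3 + instantiation); this file closes no socket.
-/

set_option autoImplicit false
set_option linter.dupNamespace false -- the mandated namespace repeats `HodgeConjecture.HodgeConjecture`

noncomputable section

open MeasureTheory Filter Topology Set
open scoped NNReal ENNReal
open Literature.NumberTheory.GaloisRepresentations.IsNonarchimedeanLocalField
open Literature.NumberTheory.Automorphic Literature.NumberTheory.Automorphic.LocalFieldHaar

namespace Summit.HodgeConjecture.HodgeConjecture.Cruxes.HLiu418.K2LiuWhittakerGammaAsTateZeta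

variable {F : Type*} [Field F] [ValuativeRel F] [TopologicalSpace F] [IsNonarchimedeanLocalField F]

/-! ## §1 Pointwise bookkeeping on `Fˣ` -/

/-- **`x⁻¹ ∉ 𝔭^N ↔ x ∈ 𝔭^{1−N}`** for `x ∈ Fˣ` (the values `‖x‖` are integral powers of `q`). [cite: Tate1950, §2.3] -/
theorem inv_notMem_primePowBall_iff (N : ℤ) (u : Fˣ) :
    ((u⁻¹ : Fˣ) : F) ∉ primePowBall F N ↔ (u : F) ∈ primePowBall F (1 - N) := by
  obtain ⟨k, hk⟩ := exists_normAbs_eq_inv_zpow (u.ne_zero)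
  rw [mem_primePowBall_iff, mem_primePowBall_iff, Units.val_inv_eq_inv_val, map_inv₀, hk, ← zpow_neg,
    inv_residueFieldCard_zpow_le_iff, inv_residueFieldCard_zpow_le_iff, not_le]
  omega

/-- `‖u⁻¹‖ = ‖u‖⁻¹` on `Fˣ`. [folklore] -/
theorem normAbs_units_inv (u : Fˣ) : normAbs F ((u⁻¹ : Fˣ) : F) = (normAbs F (u : F))⁻¹ := by
  rw [Units.val_inv_eq_inv_val, map_inv₀]

/-- for a positive real `r` (as a complex number) and any `e`: `(r⁻¹)^{−e} = r^{e}`. [folklore] -/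
theorem ofReal_inv_cpow_neg {r : ℝ} (hr : 0 < r) (e : ℂ) : (((r : ℂ))⁻¹) ^ (-e) = (r : ℂ) ^ e := by
  have harg : (r : ℂ).arg ≠ Real.pi := by
    rw [Complex.arg_ofReal_of_nonneg hr.le]
    exact Real.pi_pos.ne
  rw [Complex.cpow_neg, Complex.inv_cpow _ _ harg, inv_inv]

/-- **THE TAIL AT AN INVERSE**: `T(u⁻¹) = C₀ · ν(u) · ‖u‖^{e}` for the tail letter `T = C₀ ν(·)⁻¹ ‖·‖^{−e}`. [cite: Casselman1980, §3] [cite: Tate1950, §2.3] -/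
theorem tail_inv_eq (ν : Fˣ →* ℂˣ) (C₀ e : ℂ) (T : F → ℂ)
    (hT : ∀ x : Fˣ, T x = C₀ * (((ν x)⁻¹ : ℂˣ) : ℂ) * ((normAbs F (x : F) : ℝ) : ℂ) ^ (-e)) (u : Fˣ) :
    T ((u⁻¹ : Fˣ) : F) = C₀ * ((ν u : ℂˣ) : ℂ) * ((normAbs F (u : F) : ℝ) : ℂ) ^ e := by
  rw [hT u⁻¹, map_inv, inv_inv, normAbs_units_inv, NNReal.coe_inv, Complex.ofReal_inv,
    ofReal_inv_cpow_neg (by exact_mod_cast normAbs_units_pos u) e]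

/-! ## §2 `Γ` against the multiplicative Haar measure `d^×x = ‖x‖⁻¹ dμ`, inverted: a Tate zeta integral -/

variable [MeasurableSpace F] [BorelSpace F] (μ : Measure F) [μ.IsAddHaarMeasure]

/-- **`Γ` IS A TATE ZETA INTEGRAL.**  For the tail letter `T = C₀ ν(·)⁻¹‖·‖^{−e}`, `a ∈ F` and a radius `N`:
`∫_{x ∉ 𝔭^N} T(x) ψ(a x⁻¹) dμ(x) = C₀ · ∫_{Fˣ} (ψ(a u) · 𝟙_{𝔭^{1−N}}(u)) · ν(u) · ‖u‖^{e−1} dμ^×(u)`, `μ^× = (‖·‖⁻¹ μ)|_{Fˣ}` (★ `integral_unitsMeasure`; inversion invariance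
of the multiplicative Haar measure ★ `isInvInvariant_of_isHaarMeasure_units`; no integrability hypothesis — both identities of Bochner integrals hold unconditionally).
[cite: Tate1950, §2.3, §2.5] [cite: CasselmanShalika1980, §4] [cite: KudlaRallis1994, §2] -/
theorem setIntegral_compl_tail_addChar_inv_eq_integral_units (ν : Fˣ →* ℂˣ) (C₀ e : ℂ) (T : F → ℂ)
    (hT : ∀ x : Fˣ, T x = C₀ * (((ν x)⁻¹ : ℂˣ) : ℂ) * ((normAbs F (x : F) : ℝ) : ℂ) ^ (-e))
    (ψ : AddChar F Circle) (a : F) (N : ℤ) :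
    ∫ x in (primePowBall F N)ᶜ, T x * ((ψ (a * x⁻¹) : ℂ)) ∂μ =
      C₀ * ∫ u : Fˣ, ((ψ (a * (u : F)) : ℂ)) * (primePowBall F (1 - N)).indicator (fun _ => (1 : ℂ)) (u : F) *
          ((ν u : ℂˣ) : ℂ) * ((normAbs F (u : F) : ℝ) : ℂ) ^ (e - 1)
        ∂(Measure.comap ((↑) : Fˣ → F) (μ.withDensity fun x => (((normAbs F x)⁻¹ : ℝ≥0) : ℝ≥0∞))) := by
  set μx : Measure Fˣ := Measure.comap ((↑) : Fˣ → F) (μ.withDensity fun x => (((normAbs F x)⁻¹ : ℝ≥0) : ℝ≥0∞)) with hμx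
  haveI : BorelSpace Fˣ := Units.borelSpace
  haveI : μx.IsHaarMeasure := isHaarMeasure_unitsMeasure μ
  haveI : μx.IsInvInvariant := isInvInvariant_of_isHaarMeasure_units μx
  -- the integrand against `dμ`, and `G := ‖x‖ ·` it (so that `‖x‖⁻¹ • G = ` the integrand everywhere, `0` included)
  set H : F → ℂ := fun x => (primePowBall F N)ᶜ.indicator (fun x => T x * ((ψ (a * x⁻¹) : ℂ))) x with hH
  set G : F → ℂ := fun x => ((normAbs F x : ℝ) : ℂ) * H x with hG
  -- Step 1: `∫_{x ∉ 𝔭^N} T ψ(a/x) dμ = ∫ H dμ = ∫ ‖x‖⁻¹ • G dμ = ∫_{Fˣ} G dμ^×`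
  have h1 : ∫ x in (primePowBall F N)ᶜ, T x * ((ψ (a * x⁻¹) : ℂ)) ∂μ = ∫ u : Fˣ, G (u : F) ∂μx := by
    rw [hμx, integral_unitsMeasure μ G, ← integral_indicator (measurableSet_primePowBall N).compl]
    refine integral_congr_ae (Filter.Eventually.of_forall fun x => ?_)
    show H x = ((normAbs F x)⁻¹ : ℝ) • G x
    by_cases hx : x = 0
    · have hxN : x ∈ primePowBall F N := by
        rw [hx]
        exact zero_mem_primePowBall N
      have h0 : H x = 0 := by
        rw [hH]
        exact Set.indicator_of_notMem (fun h => (Set.mem_compl_iff _ _).1 h hxN) _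
      rw [hG]
      beta_reduce
      rw [h0, mul_zero, smul_zero]
    · have hr : ((normAbs F x : ℝ) : ℂ) ≠ 0 := by exact_mod_cast (map_ne_zero (normAbs F)).2 hx
      rw [hG]
      beta_reduce
      rw [Complex.real_smul, Complex.ofReal_inv, ← mul_assoc, inv_mul_cancel₀ hr, one_mul]
  -- Step 2: inversion on `Fˣ`
  have h2 : ∫ u : Fˣ, G (u : F) ∂μx = ∫ u : Fˣ, G ((u⁻¹ : Fˣ) : F) ∂μx := (integral_inv_eq_self (fun u : Fˣ => G (u : F)) μx).symm
  -- Step 3: the inverted integrand is Tate's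
  have h3 : ∀ u : Fˣ, G ((u⁻¹ : Fˣ) : F) =
      C₀ * (((ψ (a * (u : F)) : ℂ)) * (primePowBall F (1 - N)).indicator (fun _ => (1 : ℂ)) (u : F) *
        ((ν u : ℂˣ) : ℂ) * ((normAbs F (u : F) : ℝ) : ℂ) ^ (e - 1)) := by
    intro u
    have hupos : (0 : ℝ) < (normAbs F (u : F) : ℝ) := by exact_mod_cast normAbs_units_pos u
    have hu0 : ((normAbs F (u : F) : ℝ) : ℂ) ≠ 0 := by exact_mod_cast hupos.ne'
    rw [hG]
    simp only [hH]
    by_cases hmem : (u : F) ∈ primePowBall F (1 - N)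
    · have hc : ((u⁻¹ : Fˣ) : F) ∈ (primePowBall F N)ᶜ := (inv_notMem_primePowBall_iff N u).2 hmem
      rw [Set.indicator_of_mem hc, Set.indicator_of_mem hmem, tail_inv_eq ν C₀ e T hT u, normAbs_units_inv, NNReal.coe_inv,
        Complex.ofReal_inv, Units.val_inv_eq_inv_val, inv_inv, mul_one, Complex.cpow_sub _ _ hu0, Complex.cpow_one]
      field_simp
    · have hc : ((u⁻¹ : Fˣ) : F) ∉ (primePowBall F N)ᶜ := fun h => hmem ((inv_notMem_primePowBall_iff N u).1 h)
      rw [Set.indicator_of_notMem hc, Set.indicator_of_notMem hmem]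
      simp only [mul_zero, zero_mul]
  rw [h1, h2, integral_congr_ae (Filter.Eventually.of_forall h3), integral_const_mul]

/-- **… IN TATE'S CURRENCY**: for any quasi-character `η` of `Fˣ` agreeing with `ν`,
`∫_{x ∉ 𝔭^N} T(x) ψ(a x⁻¹) dμ(x) = C₀ · tateZeta μ^× (ψ(a·)·𝟙_{𝔭^{1−N}}) η (e − 1)` (★ `TateLocalFactors.tateZeta` against `μ^× = (‖·‖⁻¹μ)|_{Fˣ}`).
[cite: Tate1950, §2.4–2.5] [cite: CasselmanShalika1980, §4] -/
theorem setIntegral_compl_tail_addChar_inv_eq_tateZeta (ν : Fˣ →* ℂˣ) (C₀ e : ℂ) (T : F → ℂ)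
    (hT : ∀ x : Fˣ, T x = C₀ * (((ν x)⁻¹ : ℂˣ) : ℂ) * ((normAbs F (x : F) : ℝ) : ℂ) ^ (-e))
    (ψ : AddChar F Circle) (a : F) (N : ℤ) (η : QuasiChar F) (hη : ∀ u : Fˣ, η u = ν u) :
    ∫ x in (primePowBall F N)ᶜ, T x * ((ψ (a * x⁻¹) : ℂ)) ∂μ =
      C₀ * tateZeta (Measure.comap ((↑) : Fˣ → F) (μ.withDensity fun x => (((normAbs F x)⁻¹ : ℝ≥0) : ℝ≥0∞)))
        (fun y => ((ψ (a * y) : ℂ)) * (primePowBall F (1 - N)).indicator (fun _ => (1 : ℂ)) y) η (e - 1) := by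
  rw [setIntegral_compl_tail_addChar_inv_eq_integral_units μ ν C₀ e T hT ψ a N, tateZeta]
  congr 1
  refine integral_congr_ae (Filter.Eventually.of_forall fun u => ?_)
  simp only [hη]

end Summit.HodgeConjecture.HodgeConjecture.Cruxes.HLiu418.K2LiuWhittakerGammaAsTateZeta

end
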